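import Literature.AlgebraicGeometry.HodgeTheory.HardLefschetzNFoldHolds
import HarnessLib

/-!
# The Kähler package `hardLefschetz_hodgeRiemann d X` from the Hodge–Riemann anisotropy alone (proved reduction)

Family `hodge`, layer `Literature/AlgebraicGeometry/HodgeTheory`. Companion of
`HardLefschetzHodgeRiemann` (the named fact `hardLefschetz_hodgeRiemann d X`: a hard Lefschetz datum
`Λ : HardLefschetzNFold d X` whose class has the sign-free Hodge–Riemann anisotropy on rational
primitive `(m,m)`-classes; Voisin I Thm. 6.25, Rem. 6.27, Thm. 6.32, §7.1.2, Thm. 7.10) and of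
`HardLefschetzNFoldHolds` (hard Lefschetz for the hyperplane class, `nonempty_hardLefschetzNFold_holds`,
now a theorem: the hyperplane-type class `H` of a projective embedding — `A^* H = e[θ_ι] ⊗ 1` — is
Kähler, a positive real multiple `r H` is rational
(`exists_pos_smul_isRationalClass_of_pullback_eq_fubiniStudy`), it lies in `N¹ H²` and moves algebraic
classes (`HyperplaneClassLefschetzOperator`)). Hence of the Kähler package only the HODGE–RIEMANN
ANISOTROPY remains, and this file records exactly that reduction:

* `lefschetzPowTo_smul`, `anisotropy_smul` — `Lʲ_{a•κ} = aʲ Lʲ_κ` (explicit target degree), so the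
  sign-free anisotropy is invariant under non-zero rescaling of the class (the rescaling `r` above);
* `hardLefschetz_hodgeRiemann_of_anisotropy` — **`hardLefschetz_hodgeRiemann d X` from the anisotropy
  of the hyperplane-type classes of `X` alone** (Voisin I Thm. 6.32 at `k = 2m`, `p = q = m`, for the
  restricted Fubini–Study metric, transported to the cup product — hodge.S15 on the summit carrier),
  through `hardLefschetz_hodgeRiemann_of_fubiniStudy`.

No definition and no named fact is introduced (D-0026). Consumer: the route item `OrthogonalSplit` of
`Summits/HodgeConjecture/HodgeConjecture/Theses/EndoscopicMiddleDegree`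
(`Theorems/EndoscopicMiddleDegreeOrthogonalSplitOfFacts`).

## References

* [VoisinHodgeI2002] C. Voisin, Hodge Theory and Complex Algebraic Geometry I (CUP 2002), §6.2.3
  Thm. 6.25, Rem. 6.27, §6.3.2 Thm. 6.32, §7.1.2, §7.1.3 Thm. 7.10.
-/

noncomputable section

open scoped Manifold ContDiff
open CategoryTheory AlgebraicGeometry

namespace Literature.AlgebraicGeometry.HodgeTheory

section HodgeTheory

open Literature.AlgebraicTopology.SingularHomology Literature.Geometry.Kaehler
open Literature.NumberTheory.Transcendental
open Literature.AlgebraicGeometry.Motives (projectiveSpace IsSmoothProjective)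
open Literature.AlgebraicGeometry.Motives.AnalytificationKaehler (fubiniStudyPullbackForm)

variable {n : ℕ} {X : Motives.SchemeOver ℂ}

/-! ### Rescaling the class rescales the Lefschetz iterates -/

/-- `Lʲ_{a•κ} = aʲ • Lʲ_κ` with explicit target degree (`lefschetzPowTo`). [cite: VoisinHodgeI2002, §6.2.3] -/
theorem lefschetzPowTo_smul {Y : Type*} [TopologicalSpace Y] (a : ℂ) (κ : singularCohomology ℂ ℂ Y 2)
    (j k m : ℕ) (hm : k + 2 * j = m) (c : singularCohomology ℂ ℂ Y k) :
    lefschetzPowTo (a • κ) j k m hm c = a ^ j • lefschetzPowTo κ j k m hm c := by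
  subst hm
  exact lefschetzPow_smul a κ j k c

/-- **The sign-free Hodge–Riemann anisotropy is invariant under non-zero rescaling of the class**:
if `η` has it (`2m + s = d`, `y` rational of type `(m,m)`, `L^{s+1}_η y = 0`, `y ≠ 0` ⟹ `Lˢ_η y ∪ y ≠ 0`)
then so does `a • η`, `a ≠ 0` (`Lʲ_{a•η} = aʲ Lʲ_η`). [cite: VoisinHodgeI2002, Thm. 6.32] -/
theorem anisotropy_smul {d : ℕ} {η : complexBetti X 2} {a : ℂ} (ha : a ≠ 0)
    (h : ∀ (m s : ℕ) (_ : 2 * m + s = d) (y : complexBetti X (2 * m)), IsRationalClass y →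
      IsOfHodgeType d X (2 * m) m m y →
      lefschetzPowTo η (s + 1) (2 * m) (2 * m + 2 * (s + 1)) rfl y = 0 → y ≠ 0 →
      cupProduct (show 2 * m + 2 * s + 2 * m = 2 * d by omega)
        (lefschetzPowTo η s (2 * m) (2 * m + 2 * s) rfl y) y ≠ 0) :
    ∀ (m s : ℕ) (_ : 2 * m + s = d) (y : complexBetti X (2 * m)), IsRationalClass y →
      IsOfHodgeType d X (2 * m) m m y →
      lefschetzPowTo (a • η) (s + 1) (2 * m) (2 * m + 2 * (s + 1)) rfl y = 0 → y ≠ 0 →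
      cupProduct (show 2 * m + 2 * s + 2 * m = 2 * d by omega)
        (lefschetzPowTo (a • η) s (2 * m) (2 * m + 2 * s) rfl y) y ≠ 0 := by
  intro m s hms y hyQ hyT hprim hy0
  rw [lefschetzPowTo_smul] at hprim
  have hprim' : lefschetzPowTo η (s + 1) (2 * m) (2 * m + 2 * (s + 1)) rfl y = 0 :=
    (smul_eq_zero.1 hprim).resolve_left (pow_ne_zero _ ha)
  rw [lefschetzPowTo_smul, map_smul, LinearMap.smul_apply]
  exact smul_ne_zero (pow_ne_zero _ ha) (h m s hms y hyQ hyT hprim' hy0)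

/-- **The Kähler package `hardLefschetz_hodgeRiemann d X` (file `HardLefschetzHodgeRiemann`) from the
Hodge–Riemann anisotropy of the hyperplane-type classes ALONE.** If, for `X` smooth projective of
dimension `d`, EVERY hyperplane-type class `H` — of any closed immersion `ι : X ⟶ ℙᴺ`, read in any
Hodge model `A` through the integration de Rham family `e = integrationDeRhamIsoFamily A.model`
(`A^* H = e[θ_ι] ⊗ 1`) — has the sign-free Hodge–Riemann anisotropy on rational primitive
`(m,m)`-classes (Voisin I Thm. 6.32 at `k = 2m`, `p = q = m`, for the Kähler metric with Kähler form
`θ_ι`: `2m + s = d`, `y` rational of type `(m,m)`, `L^{s+1} y = 0`, `y ≠ 0` ⟹ `Lˢ y ∪ y ≠ 0`), then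
`hardLefschetz_hodgeRiemann d X` holds: a positive real multiple `r H` is rational
(`exists_pos_smul_isRationalClass_of_pullback_eq_fubiniStudy`), the anisotropy passes to `r H`
(`anisotropy_smul`), and `hardLefschetz_hodgeRiemann_of_fubiniStudy` (`HyperplaneClassLefschetzOperator`)
assembles the datum. This is the exact residue of that fact: hodge.S15 for the restricted Fubini–Study
metric, transported to the cup product. [cite: VoisinHodgeI2002, Thm. 6.25, Thm. 6.32, §7.1.2 and Thm. 7.10] -/
theorem hardLefschetz_hodgeRiemann_of_anisotropy {d : ℕ}
    (h : IsSmoothProjective d X → ∀ (A : HodgeModel d X) (N : ℕ)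
      (ι : X ⟶ Motives.projectiveSpace N ℂ) [IsClosedImmersion ι.left]
      (hθ : fubiniStudyPullbackForm A.model ι A.toComplexPoints ∈ closedSmoothForms 𝓘(ℝ, A.model) A.carrier ℝ 2)
      (H : complexBetti X 2),
      A.pullback 2 H = ofRealClass A.carrier 2 (integrationDeRhamIsoFamily A.model A.carrier 2
        (deRhamCohomology.mk ⟨fubiniStudyPullbackForm A.model ι A.toComplexPoints, hθ⟩)) →
      ∀ (m s : ℕ) (_ : 2 * m + s = d) (y : complexBetti X (2 * m)), IsRationalClass y →
        IsOfHodgeType d X (2 * m) m m y →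
        lefschetzPowTo H (s + 1) (2 * m) (2 * m + 2 * (s + 1)) rfl y = 0 → y ≠ 0 →
        cupProduct (show 2 * m + 2 * s + 2 * m = 2 * d by omega)
          (lefschetzPowTo H s (2 * m) (2 * m + 2 * s) rfl y) y ≠ 0) :
    hardLefschetz_hodgeRiemann d X := by
  refine hardLefschetz_hodgeRiemann_of_fubiniStudy fun hX ↦ ?_
  obtain ⟨N, ι, hι⟩ := hX.isProjectiveOver
  obtain ⟨A⟩ := (nonempty_hodgeModel_holds (n := d) (X := X)).nonempty hX
  have hθ := A.fubiniStudyPullbackForm_mem_closedSmoothForms ι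
  obtain ⟨H, hH⟩ := A.pullback_surjective 2 (ofRealClass A.carrier 2
    (integrationDeRhamIsoFamily A.model A.carrier 2
      (deRhamCohomology.mk ⟨fubiniStudyPullbackForm A.model ι A.toComplexPoints, hθ⟩)))
  obtain ⟨r, hr, hrat⟩ := exists_pos_smul_isRationalClass_of_pullback_eq_fubiniStudy hX A ι
    (integrationDeRhamIsoFamily A.model) integrationDeRhamIsoFamily_isNatural hθ hH
  have hr0 : (r : ℂ) ≠ 0 := by exact_mod_cast hr.ne'
  exact ⟨A, N, ι, inferInstance, integrationDeRhamIsoFamily A.model, integrationDeRhamIsoFamily_isNatural,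
    integrationDeRhamIsoFamily_isMultiplicative, hθ, H, r, hH, hr, hrat,
    anisotropy_smul hr0 (h hX A N ι hθ H hH)⟩

end HodgeTheory

end Literature.AlgebraicGeometry.HodgeTheory

end
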